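import Literature.Computability.Complexity.TVCheckerPointBricks
import HarnessLib

/-!
# `FP` bricks for the downward checker of Trevisan–Vadhan's language, III: one stage of a run — the
# oracle's interpolant at `0`, `1` and the challenge, the rule's value, the previous claim

Literature / complexity — third machine layer of the downward checker (sequels: `TVCheckerBricks.lean`
Lagrange evaluation, `TVCheckerPointBricks.lean` stage data / points / answers; analysis
`TVDownwardCheckerAnalysis.lean`). On the stage record `S = ⟨core, ⟨1ᵗ, 1ˢ⟩⟩` (run `t`, stage `s`,
absolute stage `k = i + s`) the bricks of this file compute, against the oracle presented by an access
brick `acc`: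

* `TVChk.sctxS`, `axisS`, `degS`, `selS`, `isQS`, `zcS`, `coinIxS`, `rhoS` — the stage data, the query
  padding `Z - s - 1` (so that the query length is `h n (k+1)`), the challenge `ρ_{t,s}` of the run;
* `TVChk.YS acc` — the answer blocks at the `stageDeg n k + 1` nodes (`nodeAnsF` at the point of the
  stage), `TVChk.evalS acc T` — the Lagrange brick on them at the evaluation point `T S`:
  **`evalS_apply`**: the bits of `(claimPoly (node n) (stageDeg n) O k xₛ).eval t`, `O` the level oracle
  `pointOracle (accOracle acc e) n`, `xₛ = pointSeq … s` (`TVChk.node_eq_nodeVal`,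
  `TVChk.lagVal_eq_eval_interp`);
* `TVChk.ES acc` — the rule's value `c k xₛ (q 0) (q 1)` (`opQuantF`/`opLinF` on the coefficient block,
  **`ES_apply`**), `TVChk.prevS acc` — the previous interpolant at the previous challenge
  (**`prevS_apply`**; the claim `claimSeq` of the unrolled run, `TVDownwardCheckerAnalysis`).

Everything is proved; definitions are `FP` string functions (no named facts, D-0026). The conjunction
over stages and runs, the input parsing and the probability statement are the next file.

## References

* C. Lund, L. Fortnow, H. Karloff, N. Nisan, J. ACM 39 (1992), §3 [LundEtAl1992].
* S. Arora, B. Barak, CUP 2009, §8.3.2–8.3.3, §1.3 [AroraBarakCC2009].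
* L. Trevisan, S. Vadhan, Comput. Complexity 16 (2007), Thm. 4.3, Lemma 4.1, Thm. 5.4 [TrevisanVadhan2007].
* R. Santhanam, SIAM J. Comput. 39 (2009), Lemma 12 [Santhanam2009].
-/

noncomputable section

namespace Literature.Computability.Complexity

namespace TVChk

open _root_.Computability Polynomial Finset Brick Plumb GF2Str HardLangM TVBrick QBFUniv SelfCorrect
  Literature.InformationTheory.Coding

/-! ### Numerics of the field and the schedule -/

/-- The nodes of the analysis are the nodes of the bricks: `node n l = nodeVal (Mof n) l`. [folklore] -/
theorem node_eq_nodeVal (n l : ℕ) : node n l = nodeVal (Mof n) l := by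
  rw [node, nodeVal, cubePt]
  congr 1
  funext t
  rw [padBits, dif_pos t.isLt, bitsOf, getD_natBits, decide_eq_true t.isLt, Bool.true_and]

/-- `Mof n ≥ 1` at positive size (`Dn n ≥ 12`). [folklore] -/
theorem one_le_Mof {n : ℕ} (hn : 0 < n) : 1 ≤ Mof n := by
  rw [Mof]
  have hN : 4 ≤ N n := by rw [N_eq]; nlinarith
  have hD : 2 ^ 1 ≤ Dn n + 1 := by
    rw [Dn]; have := Nat.mul_le_mul hN (le_max_left 3 (2 * n)); omega
  exact Nat.le_log_of_pow_le (by norm_num) hD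

/-- `stageDeg n k + 1 ≤ 2^{Mof n + 1}` at positive size. [folklore] -/
theorem stageDeg_succ_le_two_pow {n : ℕ} (hn : 0 < n) (k : ℕ) : stageDeg n k + 1 ≤ 2 ^ (Mof n + 1) := by
  have h1 := two_mul_stageDeg_le hn k
  have h2 := two_pow_blk_ge n
  rw [show blk n = Mof n + 1 from rfl] at h2
  omega

/-- The operator of a stage: a quantifier at offset `0`, else a linearization. [cite: TrevisanVadhan2007, Lemma 4.1 (proof)] -/
theorem op_cases {n k : ℕ} (hn : 0 < n) (hk : k < mlen n) :
    (k % (N n + 1) = 0 ∧ opAt n hn k = UOp.quant ⟨k / (N n + 1), block_lt_of_lt_mlen hk⟩) ∨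
    (∃ v : Fin (N n), k % (N n + 1) = v.val + 1 ∧ opAt n hn k = UOp.lin v) := by
  rw [opAt_eq hn hk]
  obtain ⟨b, t, ht, hkt⟩ := exists_block_of_lt_mlen hk
  obtain ⟨hmod, hdiv⟩ := block_divMod (n := n) b.val t ht
  subst hkt
  rcases t with _ | v
  · left
    refine ⟨hmod, ?_⟩
    have hb : (⟨(b.val * (N n + 1) + 0) / (N n + 1), block_lt_of_lt_mlen hk⟩ : Fin n) = b := Fin.ext hdiv
    rw [hb]
    simp only [Nat.add_zero]
    exact uops_getElem_zero n b
  · right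
    refine ⟨⟨v, by omega⟩, hmod, uops_getElem_succ n b ⟨v, by omega⟩⟩

/-! ### Stage data on the stage record -/

section StageData

/-- `sCtx n (i + s)` of a stage record. [folklore] -/
def sctxS : List Bool → List Bool := fanoutFn qN (appF ∘ fanoutFn qI qS)
/-- The axis of the stage (unary). [folklore] -/
def axisS : List Bool → List Bool := axisOf ∘ sctxS
/-- The node count of the stage (unary). [folklore] -/
def degS : List Bool → List Bool := degOf ∘ sctxS
/-- The selector index of the stage's block (unary). [folklore] -/
def selS : List Bool → List Bool := selOf ∘ sctxS
/-- Quantifier stage? [folklore] -/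
def isQS : List Bool → List Bool := isQuantOf ∘ sctxS
/-- The query padding `1^{Z - s - 1}`. [folklore] -/
def zcS : List Bool → List Bool := dropFn ∘ fanoutFn (List.cons true ∘ qS) qZ
/-- The coin block index `1^{t m' + s}`. [folklore] -/
def coinIxS : List Bool → List Bool := appF ∘ fanoutFn (HashBricks.umulFn ∘ fanoutFn qT qM) qS
/-- **The challenge `ρ_{t,s}`** of the run (block `t m' + s` of the coins). [cite: LundEtAl1992, §3] -/
def rhoS : List Bool → List Bool := blockAt ∘ fanoutFn qR (fanoutFn coinIxS qF)

/-- These are in `FP`. [folklore] -/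
theorem stageData_mem_FP : sctxS ∈ FP ∧ axisS ∈ FP ∧ degS ∈ FP ∧ selS ∈ FP ∧ isQS ∈ FP ∧ zcS ∈ FP ∧ coinIxS ∈ FP ∧ rhoS ∈ FP := by
  obtain ⟨-, hR, -, hN, hI, hM, hZ, hF, hT, hS⟩ := q_mem_FP
  have hc : sctxS ∈ FP := fanoutFn_mem_FP hN (comp_mem_FP appF_mem_FP (fanoutFn_mem_FP hI hS))
  have hci : coinIxS ∈ FP := comp_mem_FP appF_mem_FP (fanoutFn_mem_FP (comp_mem_FP HashBricks.umulFn_mem_FP (fanoutFn_mem_FP hT hM)) hS)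
  exact ⟨hc, comp_mem_FP axisSel_mem_FP.1 hc, comp_mem_FP degOf_mem_FP hc, comp_mem_FP axisSel_mem_FP.2 hc,
    comp_mem_FP sdata_mem_FP.2.2 hc, comp_mem_FP dropFn_mem_FP (fanoutFn_mem_FP (comp_mem_FP (cons_mem_FP true) hS) hZ), hci,
    comp_mem_FP blockAt_mem_FP (fanoutFn_mem_FP hR (fanoutFn_mem_FP hci hF))⟩

variable {n : ℕ} (hn : 0 < n) (w r e : List Bool) {i m' Z t s : ℕ}

/-- `sctxS` on a stage record. [folklore] -/
theorem sctxS_apply : sctxS (stRec (coreRec w r e n i m' Z (modStr (Mof n))) t s) = sCtx n (i + s) := by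
  obtain ⟨-, -, -, hN, hI, -, -, -, -, hS⟩ := q_apply w r e n i m' Z (modStr (Mof n)) t s
  rw [sctxS, fanoutFn_apply, hN, Function.comp_apply, fanoutFn_apply, hI, hS, appF_boolPair, sCtx, ones, ones, ones,
    List.replicate_append_replicate]

/-- **The stage data on a stage record** (`i + s < mlen n`). [cite: TrevisanVadhan2007, Lemma 4.1 (proof)] -/
theorem stageData_apply (hs : i + s < mlen n) :
    axisS (stRec (coreRec w r e n i m' Z (modStr (Mof n))) t s) = ones (opVar (opAt n hn (i + s))).val ∧
    degS (stRec (coreRec w r e n i m' Z (modStr (Mof n))) t s) = ones (stageDeg n (i + s) + 1) ∧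
    selS (stRec (coreRec w r e n i m' Z (modStr (Mof n))) t s) = ones (lay n (.s ⟨(i + s) / (N n + 1), block_lt_of_lt_mlen hs⟩)).val ∧
    isQS (stRec (coreRec w r e n i m' Z (modStr (Mof n))) t s) = [decide ((i + s) % (N n + 1) = 0)] := by
  have hc := sctxS_apply w r e (n := n) (i := i) (m' := m') (Z := Z) (t := t) (s := s)
  refine ⟨?_, ?_, ?_, ?_⟩
  · rw [axisS, Function.comp_apply, hc, axisOf_apply hs, opAt_eq hn hs]
  · rw [degS, Function.comp_apply, hc, degOf_apply hn]
  · rw [selS, Function.comp_apply, hc, selOf_apply hs]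
  · rw [isQS, Function.comp_apply, hc, (sdata_apply n (i + s)).2.2]

/-- The query padding on a stage record. [folklore] -/
theorem zcS_apply : zcS (stRec (coreRec w r e n i m' Z (modStr (Mof n))) t s) = ones (Z - (s + 1)) := by
  obtain ⟨-, -, -, -, -, -, hZ, -, -, hS⟩ := q_apply w r e n i m' Z (modStr (Mof n)) t s
  rw [zcS, Function.comp_apply, fanoutFn_apply, Function.comp_apply, hS, hZ, dropFn_boolPair]
  simp [ones]

/-- The coin block index on a stage record. [folklore] -/
theorem coinIxS_apply : coinIxS (stRec (coreRec w r e n i m' Z (modStr (Mof n))) t s) = ones (t * m' + s) := by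
  obtain ⟨-, -, -, -, -, hM, -, -, hT, hS⟩ := q_apply w r e n i m' Z (modStr (Mof n)) t s
  rw [coinIxS, Function.comp_apply, fanoutFn_apply, Function.comp_apply, fanoutFn_apply, hT, hM, hS, HashBricks.umulFn_apply,
    fstF_boolPair, sndF_boolPair, appF_boolPair]
  simp [ones]

/-- **The challenge on a stage record** (coins long enough). [cite: LundEtAl1992, §3] -/
theorem rhoS_apply (hr : (t * m' + s + 1) * blk n ≤ r.length) :
    rhoS (stRec (coreRec w r e n i m' Z (modStr (Mof n))) t s) = bits (Mof n) (runCoins n r t m' s) := by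
  obtain ⟨-, hR, -, -, -, -, -, hF, -, -⟩ := q_apply w r e n i m' Z (modStr (Mof n)) t s
  rw [rhoS, Function.comp_apply, fanoutFn_apply, fanoutFn_apply, hR, coinIxS_apply, hF, blockAt_apply, blk_coins n r hr, runCoins]

end StageData

/-! ### The answers at the nodes, and the interpolant's values -/

section Interpolant

/-- The node-answer context of the stage. [folklore] -/
def naS : List Bool → List Bool := fanoutFn (fanoutFn pointF (fanoutFn axisS degS)) (fanoutFn (fanoutFn zcS qF) qE)

/-- **The answer blocks of the stage**, against the oracle presented by `acc`. [cite: LundEtAl1992, §3] -/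
def YS (acc : List Bool → List Bool) : List Bool → List Bool := nodeAnsF acc ∘ naS

/-- **The interpolant evaluated** at the point delivered by the brick `T`. [cite: LundEtAl1992, §3] [cite: AroraBarakCC2009, §A.6] -/
def evalS (acc T : List Bool → List Bool) : List Bool → List Bool := lagF ∘ fanoutFn (fanoutFn T (YS acc)) (fanoutFn degS qF)

/-- These are in `FP` (for `acc, T ∈ FP`). [folklore] -/
theorem evalS_mem_FP {acc T : List Bool → List Bool} (hacc : acc ∈ FP) (hT : T ∈ FP) : naS ∈ FP ∧ YS acc ∈ FP ∧ evalS acc T ∈ FP := by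
  obtain ⟨-, hax, hdeg, -, -, hzc, -, -⟩ := stageData_mem_FP
  obtain ⟨-, -, hE, -, -, -, -, hF, -, -⟩ := q_mem_FP
  have hna : naS ∈ FP := fanoutFn_mem_FP (fanoutFn_mem_FP pointF_mem_FP (fanoutFn_mem_FP hax hdeg))
    (fanoutFn_mem_FP (fanoutFn_mem_FP hzc hF) hE)
  have hY : YS acc ∈ FP := comp_mem_FP (nodeAnsF_mem_FP hacc) hna
  exact ⟨hna, hY, comp_mem_FP lagF_mem_FP (fanoutFn_mem_FP (fanoutFn_mem_FP hT hY) (fanoutFn_mem_FP hdeg hF))⟩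

variable {n : ℕ} (hn : 0 < n) (acc : List Bool → List Bool) {w : List Bool} (hw : ptLen n ≤ w.length) (r e : List Bool)
  {i m' t s : ℕ} (him : i + m' = mlen n) (hs : s < m') (hr : (t * m' + m') * blk n ≤ r.length)

/-- The level oracle presented by `acc` on the carrier `e`. [folklore] -/
def levelO (acc : List Bool → List Bool) (e : List Bool) (n : ℕ) (lvl : ℕ) (y : Fin (N n) → K n) : K n :=
  pointOracle (accOracle acc e) n lvl y

/-- The query length of the stage is canonical: `ptLen n + blk n + (Z - (s+1)) = h n (i+s+1)` for
`Z = pre n + mlen n - i`. [folklore] -/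
theorem queryLen_eq (him : i + m' = mlen n) (hs : s < m') :
    ptLen n + blk n + (pre n + mlen n - i - (s + 1)) = h n (i + s + 1) := by
  rw [h]; omega

include hn hw him hs hr in
/-- **The answer blocks of the stage**: block `u < stageDeg n (i+s) + 1` is the bits of the level-`(i+s+1)`
oracle at the stage's point with the axis coordinate set to node `u`. [cite: LundEtAl1992, §3] -/
theorem YS_apply : ∀ u < stageDeg n (i + s) + 1,
    HashBricks.blk (YS acc (stRec (coreRec w r e n i m' (pre n + mlen n - i) (modStr (Mof n))) t s)) (Mof n + 1) u =
      bits (Mof n) (levelO acc e n (i + s + 1)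
        (Function.update ((tvChain n hn).pointSeq i (xOf n w) (runCoins n r t m') s) (opVar (opAt n hn (i + s))) (node n u))) := by
  intro u hu
  have his : i + s < mlen n := by omega
  obtain ⟨hax, hdeg, -, -⟩ := stageData_apply hn w r e (m' := m') (Z := pre n + mlen n - i) (t := t) his
  obtain ⟨-, -, hE, -, -, -, -, hF, -, -⟩ := q_apply w r e n i m' (pre n + mlen n - i) (modStr (Mof n)) t s
  have hna : naS (stRec (coreRec w r e n i m' (pre n + mlen n - i) (modStr (Mof n))) t s) =
      naCtx (ptBits n ((tvChain n hn).pointSeq i (xOf n w) (runCoins n r t m') s)) (opVar (opAt n hn (i + s))).val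
        (stageDeg n (i + s) + 1) (pre n + mlen n - i - (s + 1)) (modStr (Mof n)) e := by
    rw [naS, fanoutFn_apply, fanoutFn_apply, fanoutFn_apply, fanoutFn_apply, fanoutFn_apply, hax, hdeg, zcS_apply, hF, hE,
      pointF_apply hn hw r e hs.le (by omega) hr, naCtx]
  rw [YS, Function.comp_apply, hna, nodeAnsF_apply acc n _ _ (stageDeg_succ_le_two_pow hn _) _ e u hu, levelO,
    ← lvlOracle_eq_pointOracle, queryLen_eq him hs, node_eq_nodeVal]

include hn hw him hs hr in
/-- **The interpolant's value**: with `T` delivering the bits of `tval`, `evalS acc T` returns the bits of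
the verifier's interpolant `claimPoly` of the level-`(i+s+1)` oracle along the axis of stage `i + s` at
the stage's point, evaluated at `tval`. [cite: LundEtAl1992, §3] [cite: AroraBarakCC2009, §A.6] -/
theorem evalS_apply {T : List Bool → List Bool} {tval : K n}
    (hT : T (stRec (coreRec w r e n i m' (pre n + mlen n - i) (modStr (Mof n))) t s) = bits (Mof n) tval) :
    evalS acc T (stRec (coreRec w r e n i m' (pre n + mlen n - i) (modStr (Mof n))) t s) =
      bits (Mof n) (((tvChain n hn).claimPoly (node n) (stageDeg n) (levelO acc e n) (i + s)
        ((tvChain n hn).pointSeq i (xOf n w) (runCoins n r t m') s)).eval tval) := by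
  have his : i + s < mlen n := by omega
  obtain ⟨-, hdeg, -, -⟩ := stageData_apply hn w r e (m' := m') (Z := pre n + mlen n - i) (t := t) his
  obtain ⟨-, -, -, -, -, -, -, hF, -, -⟩ := q_apply w r e n i m' (pre n + mlen n - i) (modStr (Mof n)) t s
  rw [evalS, Function.comp_apply, fanoutFn_apply, fanoutFn_apply, fanoutFn_apply, hT, hdeg, hF, ← lCtx,
    lagF_apply (Mof n) (one_le_Mof hn) (stageDeg_succ_le_two_pow hn _)
      (y := fun u => levelO acc e n (i + s + 1) (Function.update ((tvChain n hn).pointSeq i (xOf n w) (runCoins n r t m') s)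
        (opVar (opAt n hn (i + s))) (node n u))) (YS_apply hn acc hw r e him hs hr) tval,
    lagVal_eq_eval_interp (Mof n) (fun l : Fin (stageDeg n (i + s) + 1) => levelO acc e n (i + s + 1)
      (Function.update ((tvChain n hn).pointSeq i (xOf n w) (runCoins n r t m') s) (opVar (opAt n hn (i + s))) (node n l.val)))
      _ (fun l => rfl) tval]
  -- identify the interpolant with the verifier's `claimPoly`
  have h1 : ChainCheck.Chain.nodesAt (node n) (stageDeg n) (i + s) =
      fun l : Fin (stageDeg n (i + s) + 1) => nodeVal (Mof n) l.val := by
    funext l; exact node_eq_nodeVal n l.val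
  have h2 : (fun l : Fin (stageDeg n (i + s) + 1) => levelO acc e n (i + s + 1)
      (Function.update ((tvChain n hn).pointSeq i (xOf n w) (runCoins n r t m') s) ((tvChain n hn).a (i + s)) (node n l.val))) =
      fun l : Fin (stageDeg n (i + s) + 1) => levelO acc e n (i + s + 1)
        (Function.update ((tvChain n hn).pointSeq i (xOf n w) (runCoins n r t m') s) (opVar (opAt n hn (i + s))) (node n l.val)) := by
    funext l; rfl
  rw [ChainCheck.Chain.claimPoly, h1, h2]

end Interpolant

/-! ### The rule's value and the previous claim -/

section Rule

/-- **The coefficient block** of the stage: the selector coordinate `s_b` of the point at a quantifier stage,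
the axis coordinate at a linearization stage. [cite: TrevisanVadhan2007, Lemma 4.1 (i)] -/
def coefS : List Bool → List Bool := blockAt ∘ fanoutFn pointF (fanoutFn (iteFn isQS selS axisS) qF)

/-- The arguments `⟨⟨coef, ⟨q 0, q 1⟩⟩, f⟩` of the operator bricks. [folklore] -/
def argsS (acc : List Bool → List Bool) : List Bool → List Bool :=
  fanoutFn (fanoutFn coefS (fanoutFn (evalS acc (zeroFrom qF)) (evalS acc (oneFrom qF)))) qF

/-- **The rule's value** `E_s = c (i+s) xₛ (q 0) (q 1)`: the quantifier step or the linearization, on the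
coefficient and the interpolant's values at `0` and `1`. [cite: TrevisanVadhan2007, Lemma 4.1 (i)] [cite: LundEtAl1992, §3] -/
def ES (acc : List Bool → List Bool) : List Bool → List Bool := iteFn isQS (opQuantF ∘ argsS acc) (opLinF ∘ argsS acc)

/-- From stage `s` to stage `s - 1` of the same run: `⟨core, ⟨1ᵗ, 1^{s-1}⟩⟩`. [folklore] -/
def decS : List Bool → List Bool := fanoutFn fstF (fanoutFn qT (dropFn ∘ fanoutFn (fun _ => [true]) qS))

/-- **The previous claim** `q_{s-1}(ρ_{t,s-1})`: the interpolant of stage `s - 1` at its challenge. [cite: LundEtAl1992, §3] -/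
def prevS (acc : List Bool → List Bool) : List Bool → List Bool := evalS acc rhoS ∘ decS

/-- These are in `FP` (for `acc ∈ FP`). [folklore] -/
theorem rule_mem_FP {acc : List Bool → List Bool} (hacc : acc ∈ FP) : coefS ∈ FP ∧ argsS acc ∈ FP ∧ ES acc ∈ FP ∧ decS ∈ FP ∧ prevS acc ∈ FP := by
  obtain ⟨-, hax, -, hsel, hq, -, -, hrho⟩ := stageData_mem_FP
  obtain ⟨-, -, -, -, -, -, -, hF, hT, hS⟩ := q_mem_FP
  have hco : coefS ∈ FP := comp_mem_FP blockAt_mem_FP (fanoutFn_mem_FP pointF_mem_FP (fanoutFn_mem_FP (iteFn_mem_FP hq hsel hax) hF))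
  have har : argsS acc ∈ FP := fanoutFn_mem_FP (fanoutFn_mem_FP hco (fanoutFn_mem_FP (evalS_mem_FP hacc (zeroFrom_mem_FP hF)).2.2
    (evalS_mem_FP hacc (oneFrom_mem_FP hF)).2.2)) hF
  have hde : decS ∈ FP := fanoutFn_mem_FP fstF_mem_FP (fanoutFn_mem_FP hT (comp_mem_FP dropFn_mem_FP (fanoutFn_mem_FP (const_mem_FP _) hS)))
  exact ⟨hco, har, iteFn_mem_FP hq (comp_mem_FP opQuantF_mem_FP har) (comp_mem_FP opLinF_mem_FP har), hde,
    comp_mem_FP (evalS_mem_FP hacc hrho).2.2 hde⟩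

variable {n : ℕ} (hn : 0 < n) (acc : List Bool → List Bool) {w : List Bool} (hw : ptLen n ≤ w.length) (r e : List Bool)
  {i m' t s : ℕ} (him : i + m' = mlen n) (hs : s < m') (hr : (t * m' + m') * blk n ≤ r.length)

/-- `decS` on a stage record. [folklore] -/
theorem decS_apply (w r e : List Bool) (n i m' Z : ℕ) (f : List Bool) (t s : ℕ) :
    decS (stRec (coreRec w r e n i m' Z f) t s) = stRec (coreRec w r e n i m' Z f) t (s - 1) := by
  obtain ⟨-, -, -, -, -, -, -, -, hT, hS⟩ := q_apply w r e n i m' Z f t s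
  rw [decS, fanoutFn_apply, fanoutFn_apply, Function.comp_apply, fanoutFn_apply, hT, hS, dropFn_boolPair, stRec, fstF_boolPair, stRec]
  simp [ones]

include hn hw him hs hr in
/-- **The rule's value on a stage record**: the bits of `c (i+s) xₛ (q 0) (q 1)` for the chain `tvChain n hn`,
`q` the verifier's interpolant of the presented level oracle. [cite: LundEtAl1992, §3] [cite: TrevisanVadhan2007, Lemma 4.1 (i)] -/
theorem ES_apply :
    ES acc (stRec (coreRec w r e n i m' (pre n + mlen n - i) (modStr (Mof n))) t s) =
      bits (Mof n) ((tvChain n hn).c (i + s) ((tvChain n hn).pointSeq i (xOf n w) (runCoins n r t m') s)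
        (((tvChain n hn).claimPoly (node n) (stageDeg n) (levelO acc e n) (i + s)
          ((tvChain n hn).pointSeq i (xOf n w) (runCoins n r t m') s)).eval 0)
        (((tvChain n hn).claimPoly (node n) (stageDeg n) (levelO acc e n) (i + s)
          ((tvChain n hn).pointSeq i (xOf n w) (runCoins n r t m') s)).eval 1)) := by
  have his : i + s < mlen n := by omega
  set S := stRec (coreRec w r e n i m' (pre n + mlen n - i) (modStr (Mof n))) t s with hSdef
  set xs := (tvChain n hn).pointSeq i (xOf n w) (runCoins n r t m') s with hxs
  set q := (tvChain n hn).claimPoly (node n) (stageDeg n) (levelO acc e n) (i + s) xs with hq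
  obtain ⟨hax, -, hsel, hQ⟩ := stageData_apply hn w r e (m' := m') (Z := pre n + mlen n - i) (t := t) his
  obtain ⟨-, -, -, -, -, -, -, hF, -, -⟩ := q_apply w r e n i m' (pre n + mlen n - i) (modStr (Mof n)) t s
  have hpt : pointF S = ptBits n xs := pointF_apply hn hw r e hs.le (by omega) hr
  have h0 : evalS acc (zeroFrom qF) S = bits (Mof n) (q.eval 0) := evalS_apply hn acc hw r e him hs hr (zeroFrom_apply (Mof n) hF)
  have h1 : evalS acc (oneFrom qF) S = bits (Mof n) (q.eval 1) := evalS_apply hn acc hw r e him hs hr (oneFrom_apply (Mof n) hF)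
  have hargs : ∀ idx : Fin (N n), iteFn isQS selS axisS S = ones idx.val →
      argsS acc S = boolPair (boolPair (bits (Mof n) (xs idx)) (boolPair (bits (Mof n) (q.eval 0)) (bits (Mof n) (q.eval 1)))) (modStr (Mof n)) := by
    intro idx hidx
    rw [argsS, fanoutFn_apply, fanoutFn_apply, fanoutFn_apply, h0, h1, hF, coefS, Function.comp_apply, fanoutFn_apply, fanoutFn_apply,
      hpt, hidx, hF, ← List.append_nil (ptBits n xs), blockAt_ptBits]
  show ES acc S = bits (Mof n) ((tvChain n hn).c (i + s) xs (q.eval 0) (q.eval 1))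
  change ES acc S = bits (Mof n) (opValue (opAt n hn (i + s)) xs (q.eval 0) (q.eval 1))
  rw [ES, iteFn_apply hQ]
  rcases op_cases hn his with ⟨hmod, hop⟩ | ⟨v, hmod, hop⟩
  · rw [decide_eq_true hmod, if_pos rfl, Function.comp_apply,
      hargs (lay n (.s ⟨(i + s) / (N n + 1), block_lt_of_lt_mlen his⟩)) (by rw [iteFn_apply hQ, decide_eq_true hmod, if_pos rfl, hsel]),
      opQuantF_apply, opQuantStr_bits, hop, opValue]
  · rw [hmod, decide_eq_false (Nat.succ_ne_zero _), if_neg Bool.false_ne_true, Function.comp_apply,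
      hargs v (by rw [iteFn_apply hQ, hmod, decide_eq_false (Nat.succ_ne_zero _), if_neg Bool.false_ne_true, hax, hop, opVar]),
      opLinF_apply, opLinStr_bits, hop, opValue]

include hn hw him hr in
/-- **The previous claim on a stage record** (`1 ≤ s ≤ m'`): the bits of the claim `claimSeq … s` of the
unrolled run — the interpolant of stage `s - 1` at the challenge `ρ_{t,s-1}`. [cite: LundEtAl1992, §3] -/
theorem prevS_apply (hs1 : 1 ≤ s) (hsm : s ≤ m') :
    prevS acc (stRec (coreRec w r e n i m' (pre n + mlen n - i) (modStr (Mof n))) t s) =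
      bits (Mof n) (((tvChain n hn).claimPoly (node n) (stageDeg n) (levelO acc e n) (i + (s - 1))
        ((tvChain n hn).pointSeq i (xOf n w) (runCoins n r t m') (s - 1))).eval (runCoins n r t m' (s - 1))) := by
  obtain ⟨s', rfl⟩ : ∃ s', s = s' + 1 := ⟨s - 1, by omega⟩
  have hs' : s' < m' := by omega
  rw [prevS, Function.comp_apply, decS_apply, Nat.add_sub_cancel]
  exact evalS_apply hn acc hw r e him hs' hr (rhoS_apply w r e (le_trans (Nat.mul_le_mul_right _ (by omega)) hr))

end Rule

end TVChk

end Literature.Computability.Complexity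

end
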